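import Literature.MathematicalPhysics.QuantumManyBody.PeriodicMaxFormSimplicity
import Literature.MathematicalPhysics.QuantumManyBody.PeriodicFormCoreTrigPoly
import Literature.MathematicalPhysics.QuantumManyBody.PeriodicClusteringFromKyFanGap
import Mathlib.MeasureTheory.Function.LpSpace.ContinuousCompMeasurePreserving
import HarnessLib

/-!
# Crux `GridInfDivCoherence` (stmt-AtomisticToContinuum-9114), line `registered`:
# positivity of the translation coherence of near-minimisers — INTEGRABLE pair profiles

Route `BECInfDivCoherence`, sub-problem `BoseEinsteinCondensation`. The crux is **(P)** "every `δ`-near-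
minimiser `Ψ` of the periodic `N`-body energy on the torus of side `L = (N/ρ)^{1/3}` has strictly positive
translation coherence `G_Ψ(i, r) = re ∫_{cell^N} conj Ψ(…, xᵢ + r, …) Ψ(X) dX`" ∧ **(Sign)**. This file proves
(P) for every repulsive finite-range `v` with INTEGRABLE profile `∫_{ℝ³} v(|x|) dx < ∞`, bounded or not
(registered stub `stub_coherencePos_integrable`; bounded case: `stub_coherencePos_bounded`; the
non-integrable hard-core class: `stub_coherencePos_nonintegrable`), on `L²((ℝ/ℤ)^{3N})` with the max-form
package of the tree:

* `W = ∑_{i<j} v^per(xᵢ - xⱼ) ∈ L¹` of the cell (`lintegral_cellN_periodicInteraction_ne_top_of_lintegral_ne_top`),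
  so the form embedding `ι = formEmbed` has spectral data `d : TwoModeData ι`, the ground state is SIMPLE as a
  strict Ky Fan inequality `2E₀ < kyFanTwo` (`two_mul_periodicGroundStateEnergy_lt_kyFanTwo`, Reed–Simon IV
  Thm XIII.48 (a)), and the embedded variational ground state `η₀ = ι φ₁` lies in the ground-state class of
  the maximal form (`formEmbed_mem_maxFormGroundStates_of_gramOp_eq`), the ray of the a.e. positive unit
  vector `f = |η₀|` (`exists_eq_smul_of_mem_maxFormGroundStates`, `ae_ne_zero_of_mem_maxFormGroundStates`).
* **Floor** (`exists_coherence_floor`): `s ↦ re⟪τ_s f, f⟫ = ∫ f(t + s) f(t) dt` is `> 0` at every `s` and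
  continuous (strong continuity of translation on `L²`, Mathlib's `Lp.compMeasurePreserving_continuous`),
  hence `≥ g > 0` on the compact torus.
* **Reference near-minimisers** (`exists_trialState_near_groundState`): normalised core functions close to
  `φ₁` in the form domain are trial states of energy `≤ E₀ + δ'` with embedded classes close to `η₀`.
* **Transfer** (`re_setIntegral_conj_translate_mul_pos`): clustering from the Ky Fan gap
  (`exists_phase_integral_norm_sub_sq_le_of_kyFanGap`) puts every `δ`-near-minimiser within `g/8` of a phase
  times a reference state, hence within `g/4` of a unit multiple of `f`; the cell coherence of `Ψ` is the
  amplitude `re⟪τ_s ιΨ, ιΨ⟫` (`inner_translate_formEmbed_trialState`) and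
  `|re⟪τa,a⟫ − re⟪τb,b⟫| ≤ ‖a−b‖(‖a‖+‖b‖)` (`abs_re_inner_map_sub_le`) gives `G_Ψ ≥ g/2 > 0` uniformly.

References: Reed–Simon IV §XIII.12, Thms XIII.44, XIII.48 (a), XIII.64 [ReedSimonIV1978]; Faris–Simon 1975.
-/

noncomputable section

namespace Summit.AtomisticToContinuum.BoseEinsteinCondensation.Theorems

open MeasureTheory Filter Literature.MathematicalPhysics.QuantumManyBody.BoseGas
  Literature.Analysis.InnerProduct
open scoped ENNReal NNReal ComplexConjugate InnerProductSpace Topology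

-- The measure on `ℝ/ℤ` is the Haar PROBABILITY measure, as in `PeriodicFormDomain.lean`; it is a Haar
-- measure and the product measure on `(ℝ/ℤ)^D` is translation invariant (`PeriodicMaxFormPositivity.lean`).
attribute [local instance] formDomain_measureSpace formDomain_isProbabilityMeasure
  formDomain_isProbabilityMeasure_pi comparison_isAddHaarMeasure comparison_isAddRightInvariant

namespace CoherencePosL2

variable {N : ℕ} {L : ℝ} {v : ℝ → ℝ≥0∞}

/-- Local notation for the Hilbert space `L²((ℝ/ℤ)^{3N})`, as in `PeriodicFormDomain.lean`. -/
local notation "L2T " N':max => Lp ℂ 2 (volume : Measure (UnitAddTorus (Fin N' × Fin 3)))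

/-- Local notation: the translation `(τ_s g)(t) = g(t + s)` on `L²((ℝ/ℤ)^{3N})`, a linear isometry (Mathlib's
`Lp.compMeasurePreservingₗᵢ` for the Haar-measure-preserving translation). -/
local notation "τ[" s "]" =>
  Lp.compMeasurePreservingₗᵢ ℂ (fun t => t + s) (measurePreserving_add_right volume s)

/-- **Stability of a transition amplitude.** For a linear isometry `U` of a complex inner product space,
`|re⟪U a, a⟫ − re⟪U b, b⟫| ≤ ‖a − b‖ (‖a‖ + ‖b‖)` (`⟪Ua,a⟫ − ⟪Ub,b⟫ = ⟪U(a−b), a⟫ + ⟪Ub, a−b⟫` and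
Cauchy–Schwarz). [folklore] -/
theorem abs_re_inner_map_sub_le {E : Type*} [NormedAddCommGroup E] [InnerProductSpace ℂ E]
    (U : E →ₗᵢ[ℂ] E) (a b : E) :
    |(⟪U a, a⟫_ℂ).re - (⟪U b, b⟫_ℂ).re| ≤ ‖a - b‖ * (‖a‖ + ‖b‖) := by
  have hsplit : ⟪U a, a⟫_ℂ - ⟪U b, b⟫_ℂ = ⟪U (a - b), a⟫_ℂ + ⟪U b, a - b⟫_ℂ := by
    rw [map_sub, inner_sub_left, inner_sub_right]; ring
  have h1 := norm_inner_le_norm (𝕜 := ℂ) (U (a - b)) a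
  have h2 := norm_inner_le_norm (𝕜 := ℂ) (U b) (a - b)
  rw [U.norm_map] at h1 h2
  rw [← Complex.sub_re, hsplit]
  refine (Complex.abs_re_le_norm _).trans ((norm_add_le _ _).trans ?_)
  nlinarith [h1, h2]

/-- A unit phase does not change the amplitude: `re⟪U (w • f), w • f⟫ = re⟪U f, f⟫` for `‖w‖ = 1`.
[folklore] -/
theorem re_inner_map_smul_self {E : Type*} [NormedAddCommGroup E] [InnerProductSpace ℂ E]
    (U : E →ₗᵢ[ℂ] E) (f : E) {w : ℂ} (hw : ‖w‖ = 1) :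
    (⟪U (w • f), w • f⟫_ℂ).re = (⟪U f, f⟫_ℂ).re := by
  rw [map_smul, inner_smul_left, inner_smul_right, ← mul_assoc, Complex.conj_mul' w, hw,
    Complex.ofReal_one, one_pow, one_mul]

/-- **Translation is strongly continuous on `L²` of the torus**: `s ↦ τ_s g` is continuous
(Mathlib's `Lp.compMeasurePreserving_continuous`). [folklore] -/
theorem continuous_translate (g : L2T N) :
    Continuous fun s : UnitAddTorus (Fin N × Fin 3) => (τ[s] g : L2T N) := by
  set F : C(UnitAddTorus (Fin N × Fin 3) × UnitAddTorus (Fin N × Fin 3), UnitAddTorus (Fin N × Fin 3)) :=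
    ⟨fun p => p.2 + p.1, by fun_prop⟩
  exact Continuous.compMeasurePreservingLp (f := fun _ => g) (g := fun s => F.curry s) continuous_const
    F.curry.continuous (fun s => measurePreserving_add_right volume s) ENNReal.ofNat_ne_top

/-- The a.e. representative of a translate: `(τ_s g)(t) = g(t + s)` a.e. [folklore] -/
theorem coeFn_translate (s : UnitAddTorus (Fin N × Fin 3)) (g : L2T N) :
    ((τ[s] g : L2T N) : UnitAddTorus (Fin N × Fin 3) → ℂ) =ᵐ[volume]
      fun t => (g : UnitAddTorus (Fin N × Fin 3) → ℂ) (t + s) :=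
  Lp.coeFn_compMeasurePreserving g _

section Dictionary

variable (hL : 0 < L) (hv : Measurable v) (hW : ∫⁻ X in cellN N L, periodicInteraction v L X ≠ ⊤)

/-- **The translation coherence is a torus amplitude.** For a periodic trial state `Ψ` with embedded class
`ιΨ ∈ L²((ℝ/ℤ)^{3N})` and any translation `C` of configuration space,
`⟪τ_s ιΨ, ιΨ⟫ = ∫_{[0,L)^{3N}} conj Ψ(X + C) Ψ(X) dX`, `s = C/L mod 1`. [folklore] -/
theorem inner_translate_formEmbed_trialState (Ψ : PeriodicTrialState N L) (C : Config N) :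
    ⟪(τ[toUnitTorusN L C] (formEmbed hL hv hW ⟨graphEmbed hL hv hW ⟨Ψ.ψ, Ψ.mem_periodicCore⟩,
        graphEmbed_mem_formDomain hL hv hW _⟩) : L2T N),
      formEmbed hL hv hW ⟨graphEmbed hL hv hW ⟨Ψ.ψ, Ψ.mem_periodicCore⟩,
        graphEmbed_mem_formDomain hL hv hW _⟩⟫_ℂ =
      ∫ X in cellN N L, conj (Ψ.ψ (X + C)) * Ψ.ψ X := by
  set e : L2T N := formEmbed hL hv hW ⟨graphEmbed hL hv hW ⟨Ψ.ψ, Ψ.mem_periodicCore⟩,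
    graphEmbed_mem_formDomain hL hv hW _⟩ with he_def
  have he : (e : UnitAddTorus (Fin N × Fin 3) → ℂ) =ᵐ[volume]
      fun t => (cellScale N L : ℂ) * Ψ.ψ (fromUnitTorusN L t) :=
    coeFn_formEmbed_graphEmbed hL hv hW ⟨Ψ.ψ, Ψ.mem_periodicCore⟩
  have hτ : ((τ[toUnitTorusN L C] e : L2T N) : UnitAddTorus (Fin N × Fin 3) → ℂ) =ᵐ[volume]
      fun t => (cellScale N L : ℂ) * Ψ.ψ (fromUnitTorusN L t + C) := by
    have h2 :=
      (measurePreserving_add_right volume (toUnitTorusN L C)).quasiMeasurePreserving.ae_eq_comp he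
    filter_upwards [coeFn_translate (toUnitTorusN L C) e, h2] with t ht1 ht2
    have h3 := torusFunN_translate hL Ψ.periodic C t
    simp only [torusFunN, Function.comp_apply] at h3 ht2
    rw [ht1, ht2, h3]
  rw [MeasureTheory.L2.inner_def, integral_congr_ae ((hτ.and he).mono fun t ht => by rw [ht.1, ht.2])]
  simp only [RCLike.inner_apply', map_mul, Complex.conj_ofReal]
  have hmeas :
      AEStronglyMeasurable (fun X => conj (Ψ.ψ (X + C)) * Ψ.ψ X) (volume.restrict (cellN N L)) :=
    (((Ψ.contDiff.continuous.comp (continuous_add_const C)).aestronglyMeasurable).star).mul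
      Ψ.contDiff.continuous.aestronglyMeasurable
  have htr : ∫ t, conj (Ψ.ψ (fromUnitTorusN L t + C)) * Ψ.ψ (fromUnitTorusN L t) =
      ((((L ^ 3)⁻¹) ^ N : ℝ)) • ∫ X in cellN N L, conj (Ψ.ψ (X + C)) * Ψ.ψ X :=
    integral_fromUnitTorusN hL (G := fun X => conj (Ψ.ψ (X + C)) * Ψ.ψ X) hmeas
  have hrw : ∀ t, (cellScale N L : ℂ) * conj (Ψ.ψ (fromUnitTorusN L t + C)) *
      ((cellScale N L : ℂ) * Ψ.ψ (fromUnitTorusN L t)) = ((cellScale N L : ℂ) * (cellScale N L : ℂ)) *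
        (conj (Ψ.ψ (fromUnitTorusN L t + C)) * Ψ.ψ (fromUnitTorusN L t)) := fun t => by ring
  simp_rw [hrw]
  rw [integral_const_mul, htr, Complex.real_smul, ← mul_assoc, ← Complex.ofReal_mul, ← sq,
    cellScale_sq hL.le, ← Complex.ofReal_mul, ← mul_pow, mul_inv_cancel₀ (pow_ne_zero 3 hL.ne'), one_pow,
    Complex.ofReal_one, one_mul]

/-- **Cell closeness is `L²` closeness of the embedded classes**: for trial states `Ψ, Φ` and a scalar `c`,
`‖ιΨ − c ιΦ‖² = ∫_{[0,L)^{3N}} ‖Ψ − cΦ‖²`. [folklore] -/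
theorem norm_formEmbed_sub_smul_sq (Ψ Φ : PeriodicTrialState N L) (c : ℂ) :
    ‖formEmbed hL hv hW ⟨graphEmbed hL hv hW ⟨Ψ.ψ, Ψ.mem_periodicCore⟩,
          graphEmbed_mem_formDomain hL hv hW _⟩ -
        c • formEmbed hL hv hW ⟨graphEmbed hL hv hW ⟨Φ.ψ, Φ.mem_periodicCore⟩,
          graphEmbed_mem_formDomain hL hv hW _⟩‖ ^ 2 =
      ∫ X in cellN N L, ‖Ψ.ψ X - c * Φ.ψ X‖ ^ 2 := by
  set D : periodicCore N L := ⟨Ψ.ψ, Ψ.mem_periodicCore⟩ - c • ⟨Φ.ψ, Φ.mem_periodicCore⟩ with hD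
  have hfun : ((D : periodicCore N L) : Config N → ℂ) = fun X => Ψ.ψ X - c * Φ.ψ X := by
    funext X
    simp only [hD, Submodule.coe_sub, Submodule.coe_smul, Pi.sub_apply, Pi.smul_apply, smul_eq_mul]
  have hembed : formEmbed hL hv hW ⟨graphEmbed hL hv hW D, graphEmbed_mem_formDomain hL hv hW D⟩ =
      formEmbed hL hv hW ⟨graphEmbed hL hv hW ⟨Ψ.ψ, Ψ.mem_periodicCore⟩,
          graphEmbed_mem_formDomain hL hv hW _⟩ -
        c • formEmbed hL hv hW ⟨graphEmbed hL hv hW ⟨Φ.ψ, Φ.mem_periodicCore⟩,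
          graphEmbed_mem_formDomain hL hv hW _⟩ := by
    simp only [formEmbed_apply, hD, map_sub, map_smul, PiLp.sub_apply, PiLp.smul_apply]
  have hcont : Continuous fun X => Ψ.ψ X - c * Φ.ψ X :=
    Ψ.contDiff.continuous.sub (continuous_const.mul Φ.contDiff.continuous)
  rw [← hembed, norm_formEmbed_graphEmbed_sq, hfun, integral_cellN_norm_sq_eq_toReal L hcont]

end Dictionary

section Reference

variable (hL : 0 < L) (hv : Measurable v) (hW : ∫⁻ X in cellN N L, periodicInteraction v L X ≠ ⊤)

/-- **The variational ground state is a ground state of the maximal form**: `ι φ₁ ∈ maxFormGroundStates`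
(`φ₁ = κ₁^{-1/2} e₁` is an eigenvector of the Gram operator for `κ₁`; bridge
`formEmbed_mem_maxFormGroundStates_of_gramOp_eq`). [cite: ReedSimonIV1978, Thm XIII.64] -/
theorem formEmbed_φ₁_mem_maxFormGroundStates (d : TwoModeData (formEmbed hL hv hW)) :
    formEmbed hL hv hW d.φ₁ ∈ maxFormGroundStates v N L := by
  refine formEmbed_mem_maxFormGroundStates_of_gramOp_eq hL hv hW d ?_
  rw [TwoModeData.φ₁, map_smul, d.gramOp_e₁, smul_smul, smul_smul, mul_comm]
  rfl

/-- **The coherence floor of the ground state.** Let `f = |ι φ₁|`, the modulus of the embedded variational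
ground state: a unit vector of the ground-state class of the maximal form, hence a.e. `> 0` on the torus
(Faris–Simon, `ae_ne_zero_of_mem_maxFormGroundStates`). Its translation coherence
`s ↦ re⟪τ_s f, f⟫ = ∫ f(t + s) f(t) dt` is strictly positive at every `s` (integral of an a.e. positive
function) and continuous (strong continuity of translation on `L²`), so on the compact torus it is bounded
below by some `g > 0`. [cite: ReedSimonIV1978, Thm XIII.44] -/
theorem exists_coherence_floor (hE : periodicGroundStateEnergy v N L ≠ ⊤)
    (d : TwoModeData (formEmbed hL hv hW)) :
    ∃ g : ℝ, 0 < g ∧ ∀ s : UnitAddTorus (Fin N × Fin 3),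
      g ≤ (⟪(τ[s] (absLp (formEmbed hL hv hW d.φ₁)) : L2T N), absLp (formEmbed hL hv hW d.φ₁)⟫_ℂ).re := by
  set f : L2T N := absLp (formEmbed hL hv hW d.φ₁) with hf_def
  have hf1 : ‖f‖ = 1 := by rw [hf_def, norm_absLp, d.norm_map_φ₁]
  have hf0 : f ≠ 0 := by rw [← norm_ne_zero_iff, hf1]; exact one_ne_zero
  have hfabs : absLp f = f := absLp_absLp _
  -- `f > 0` a.e.: `f ≠ 0` a.e. (Faris–Simon) and `f = |f|`
  have hne := ae_ne_zero_of_mem_maxFormGroundStates hL hv hW hE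
    (absLp_mem_maxFormGroundStates (formEmbed_φ₁_mem_maxFormGroundStates hL hv hW d)) hfabs hf0
  have hreal : (f : UnitAddTorus (Fin N × Fin 3) → ℂ) =ᵐ[volume]
      fun t => ((‖(f : UnitAddTorus (Fin N × Fin 3) → ℂ) t‖ : ℝ) : ℂ) := by
    have h := coeFn_absLp f
    rwa [hfabs] at h
  -- pointwise positivity of the coherence (adapted from `re_inner_pos_of_absLp_eq`)
  have hpos : ∀ s : UnitAddTorus (Fin N × Fin 3), 0 < (⟪(τ[s] f : L2T N), f⟫_ℂ).re := by
    intro s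
    have hqmp := (measurePreserving_add_right
      (volume : Measure (UnitAddTorus (Fin N × Fin 3))) s).quasiMeasurePreserving
    have hτreal : ((τ[s] f : L2T N) : UnitAddTorus (Fin N × Fin 3) → ℂ) =ᵐ[volume]
        fun t => ((‖(f : UnitAddTorus (Fin N × Fin 3) → ℂ) (t + s)‖ : ℝ) : ℂ) := by
      filter_upwards [coeFn_translate s f, hqmp.ae_eq_comp hreal] with t h1 h2
      simp only [Function.comp_apply] at h2
      rw [h1, h2, Complex.norm_real, norm_norm]
    have hτne : ∀ᵐ t ∂(volume : Measure (UnitAddTorus (Fin N × Fin 3))),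
        (f : UnitAddTorus (Fin N × Fin 3) → ℂ) (t + s) ≠ 0 := hqmp.ae hne
    rw [MeasureTheory.L2.inner_def, ← RCLike.re_to_complex, ← integral_re (L2.integrable_inner _ _)]
    refine (integral_pos_iff_support_of_nonneg_ae ?_ (L2.integrable_inner _ _).re).2 ?_
    · filter_upwards [hτreal, hreal] with t h1 h2
      rw [Pi.zero_apply, RCLike.inner_apply', h1, h2, Complex.conj_ofReal, ← Complex.ofReal_mul,
        RCLike.re_to_complex, Complex.ofReal_re]
      positivity
    · have hsupp : ∀ᵐ t ∂(volume : Measure (UnitAddTorus (Fin N × Fin 3))),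
          t ∈ Function.support fun t => RCLike.re
            ⟪((τ[s] f : L2T N) : UnitAddTorus (Fin N × Fin 3) → ℂ) t, (f : UnitAddTorus (Fin N × Fin 3) → ℂ) t⟫_ℂ := by
        filter_upwards [hτne, hne, hτreal, hreal] with t h1 h2 h3 h4
        rw [Function.mem_support, RCLike.inner_apply', h3, h4, Complex.conj_ofReal, ← Complex.ofReal_mul,
          RCLike.re_to_complex, Complex.ofReal_re]
        rw [h4] at h2
        exact mul_ne_zero (norm_ne_zero_iff.2 h1) fun h => h2 (by rw [h, Complex.ofReal_zero])
      have hcompl : volume (Function.support fun t => RCLike.re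
          ⟪((τ[s] f : L2T N) : UnitAddTorus (Fin N × Fin 3) → ℂ) t, (f : UnitAddTorus (Fin N × Fin 3) → ℂ) t⟫_ℂ)ᶜ =
          0 := mem_ae_iff.1 hsupp
      rw [measure_congr (ae_eq_univ.2 hcompl), measure_univ]; exact one_pos
  -- continuity in `s` and compactness of the torus
  have hcont : Continuous fun s : UnitAddTorus (Fin N × Fin 3) => (⟪(τ[s] f : L2T N), f⟫_ℂ).re :=
    Complex.continuous_re.comp ((continuous_translate f).inner continuous_const)
  obtain ⟨s₀, -, hmin⟩ := isCompact_univ.exists_isMinOn Set.univ_nonempty hcont.continuousOn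
  exact ⟨_, hpos s₀, fun s => hmin (Set.mem_univ s)⟩

/-- **Near-minimisers close to the ground state exist at every slack**: for `δ, ε > 0` there is a periodic
trial state `Φ` with `periodicEnergy v Φ ≤ E₀ + δ` whose embedded class is `ε`-close in `L²((ℝ/ℤ)^{3N})` to
the embedded variational ground state `ι φ₁` (normalise core elements of the form domain close to `φ₁`; the
core is dense, `dense_coreRange`). [cite: ReedSimonIV1978, Thm XIII.1] -/
theorem exists_trialState_near_groundState (d : TwoModeData (formEmbed hL hv hW)) {δ ε : ℝ} (hδ : 0 < δ)
    (hε : 0 < ε) :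
    ∃ Φ : PeriodicTrialState N L,
      periodicEnergy v Φ ≤ periodicGroundStateEnergy v N L + ENNReal.ofReal δ ∧
      ‖formEmbed hL hv hW ⟨graphEmbed hL hv hW ⟨Φ.ψ, Φ.mem_periodicCore⟩,
          graphEmbed_mem_formDomain hL hv hW _⟩ - formEmbed hL hv hW d.φ₁‖ < ε := by
  have hφ : formEmbed hL hv hW d.φ₁ ≠ 0 := by rw [← norm_ne_zero_iff, d.norm_map_φ₁]; exact one_ne_zero
  have hu : ContinuousAt (mapNormalize (formEmbed hL hv hW)) d.φ₁ := continuousAt_mapNormalize _ hφ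
  have h1 : ∀ᶠ s in 𝓝 d.φ₁, ‖mapNormalize (formEmbed hL hv hW) s‖ ^ 2 < d.κ₁⁻¹ + δ := by
    refine ((hu.norm).pow 2).eventually_lt_const ?_
    show ‖mapNormalize (formEmbed hL hv hW) d.φ₁‖ ^ 2 < d.κ₁⁻¹ + δ
    rw [mapNormalize_of_norm_eq_one _ d.norm_map_φ₁, d.norm_φ₁_sq]
    linarith
  have h2 : ∀ᶠ s in 𝓝 d.φ₁, formEmbed hL hv hW s ≠ 0 := by
    have hval : (1 / 2 : ℝ) < ‖formEmbed hL hv hW d.φ₁‖ := by rw [d.norm_map_φ₁]; norm_num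
    refine ((formEmbed hL hv hW).continuous.norm.continuousAt.eventually_const_lt hval).mono
      fun s hs h0 => ?_
    rw [h0, norm_zero] at hs
    linarith
  have h3 : ∀ᶠ s in 𝓝 d.φ₁, dist (formEmbed hL hv hW (mapNormalize (formEmbed hL hv hW) s))
      (formEmbed hL hv hW d.φ₁) < ε := by
    have hca : ContinuousAt (fun s => formEmbed hL hv hW (mapNormalize (formEmbed hL hv hW) s)) d.φ₁ :=
      (formEmbed hL hv hW).continuous.continuousAt.comp hu
    have h : ∀ᶠ s in 𝓝 d.φ₁, dist (formEmbed hL hv hW (mapNormalize (formEmbed hL hv hW) s))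
        (formEmbed hL hv hW (mapNormalize (formEmbed hL hv hW) d.φ₁)) < ε :=
      Metric.tendsto_nhds.1 hca ε hε
    rwa [mapNormalize_of_norm_eq_one _ d.norm_map_φ₁] at h
  obtain ⟨s, hsS, hs1, hs2, hs3⟩ := (dense_coreRange hL hv hW).inter_nhds_nonempty (h1.and (h2.and h3))
  have hψ1 : ‖formEmbed hL hv hW (mapNormalize (formEmbed hL hv hW) s)‖ = 1 :=
    norm_map_mapNormalize _ hs2
  obtain ⟨Φc, hΦc⟩ := exists_eq_graphEmbed_of_mem_coreRange (mapNormalize_mem (formEmbed hL hv hW) hsS)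
  rw [hΦc] at hψ1 hs1 hs3
  refine ⟨PeriodicTrialState.ofCore hL hv hW Φc hψ1, ?_, ?_⟩
  · rw [periodicEnergy_ofCore hL hv hW Φc hψ1, periodicGroundStateEnergy_eq_ofReal d,
      ← ENNReal.ofReal_add (by linarith [twoModeData_one_le_inv_κ₁ d]) hδ.le]
    refine ENNReal.ofReal_le_ofReal ?_
    change ‖graphEmbed hL hv hW Φc‖ ^ 2 < d.κ₁⁻¹ + δ at hs1
    linarith
  · rw [← dist_eq_norm]; exact hs3

end Reference

/-- **Positivity of the translation coherence of near-minimisers, fixed box** (`N ≥ 1`, `L > 0`, `v`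
measurable with `W = ∑_{i<j} v^per(xᵢ - xⱼ) ∈ L¹` of the cell): some `δ > 0` makes every periodic trial state
`Ψ` with `periodicEnergy v Ψ ≤ E₀ + δ` satisfy `re ∫_{[0,L)^{3N}} conj Ψ(X + C) Ψ(X) dX > 0` for EVERY
translation `C`. Ky Fan gap `2E₀ + γ ≤ kyFanTwo` (simplicity, Reed–Simon XIII.48 (a)); the ground-state class
is the ray of the a.e. positive `f = |ι φ₁|`, whose coherence has a floor `g > 0`; clustering with
`η = (g/8)²` puts every `δ`-near-minimiser within `g/4` of a unit multiple of `f` in `L²`; the stability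
`|re⟪τa,a⟫ − re⟪τb,b⟫| ≤ ‖a−b‖(‖a‖+‖b‖)` gives coherence `≥ g/2 > 0`. [cite: ReedSimonIV1978, Thm XIII.48 (a)] -/
theorem re_setIntegral_conj_translate_mul_pos (hN : 1 ≤ N) (hL : 0 < L) (hv : Measurable v)
    (hW : ∫⁻ X in cellN N L, periodicInteraction v L X ≠ ⊤) :
    ∃ δ : ℝ≥0∞, 0 < δ ∧ ∀ Ψ : PeriodicTrialState N L,
      periodicEnergy v Ψ ≤ periodicGroundStateEnergy v N L + δ →
        ∀ C : Config N, 0 < (∫ X in cellN N L, conj (Ψ.ψ (X + C)) * Ψ.ψ X).re := by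
  obtain ⟨d⟩ := nonempty_twoModeData hL hv hW hN
  have hEtop : periodicGroundStateEnergy v N L ≠ ⊤ := by
    rw [periodicGroundStateEnergy_eq_ofReal d]; exact ENNReal.ofReal_ne_top
  -- the gap, the reference ray and its floor
  obtain ⟨γ, hγ, hgap⟩ :
      ∃ γ : ℝ, 0 < γ ∧ 2 * periodicGroundStateEnergy v N L + ENNReal.ofReal γ ≤ kyFanTwo v N L := by
    obtain ⟨r, hr, hlt⟩ :=
      ENNReal.lt_iff_exists_add_pos_lt.1 (two_mul_periodicGroundStateEnergy_lt_kyFanTwo hN hL hv hW)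
    exact ⟨r, hr, by rw [ENNReal.ofReal_coe_nnreal]; exact hlt.le⟩
  obtain ⟨g, hg, hfloor⟩ := exists_coherence_floor hL hv hW hEtop d
  have hmem := formEmbed_φ₁_mem_maxFormGroundStates hL hv hW d
  have hf1 : ‖absLp (formEmbed hL hv hW d.φ₁)‖ = 1 := by rw [norm_absLp, d.norm_map_φ₁]
  have hf0 : absLp (formEmbed hL hv hW d.φ₁) ≠ 0 := by rw [← norm_ne_zero_iff, hf1]; exact one_ne_zero
  obtain ⟨c, hc⟩ := exists_eq_smul_of_mem_maxFormGroundStates hL hv hW hEtop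
    (absLp_mem_maxFormGroundStates hmem) (absLp_absLp _) hf0 hmem
  have hc1 : ‖c‖ = 1 := by
    simpa only [norm_smul, hf1, mul_one, d.norm_map_φ₁] using (congrArg norm hc).symm
  set η₀ : L2T N := formEmbed hL hv hW d.φ₁ with hη₀
  set f : L2T N := absLp η₀ with hf
  -- the clustering modulus
  obtain ⟨δ, hδ, hclus⟩ :=
    exists_phase_integral_norm_sub_sq_le_of_kyFanGap hv hγ hEtop hgap (by positivity : 0 < (g / 8) ^ 2)
  refine ⟨δ, hδ, fun Ψ hΨ C => ?_⟩
  -- a reference near-minimiser close to `η₀`, and the phase aligning it with `Ψ`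
  have hmin_top : min δ 1 ≠ ⊤ := ne_top_of_le_ne_top ENNReal.one_ne_top (min_le_right _ _)
  have hδr0 : 0 < (min δ 1).toReal := ENNReal.toReal_pos (lt_min hδ zero_lt_one).ne' hmin_top
  obtain ⟨Φ, hΦE, hΦclose⟩ :=
    exists_trialState_near_groundState hL hv hW d hδr0 (by positivity : 0 < g / 8)
  have hΦE' : periodicEnergy v Φ ≤ periodicGroundStateEnergy v N L + δ := by
    refine hΦE.trans (add_le_add le_rfl ?_)
    rw [ENNReal.ofReal_toReal hmin_top]; exact min_le_left _ _
  obtain ⟨θ, hθ⟩ := hclus Ψ Φ hΨ hΦE'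
  -- the embedded classes
  set eΨ : L2T N := formEmbed hL hv hW ⟨graphEmbed hL hv hW ⟨Ψ.ψ, Ψ.mem_periodicCore⟩,
    graphEmbed_mem_formDomain hL hv hW _⟩ with heΨ
  set eΦ : L2T N := formEmbed hL hv hW ⟨graphEmbed hL hv hW ⟨Φ.ψ, Φ.mem_periodicCore⟩,
    graphEmbed_mem_formDomain hL hv hW _⟩ with heΦ
  have heΨ1 : ‖eΨ‖ = 1 := norm_formEmbed_graphEmbed_trialState hL hv hW Ψ
  have hw1 : ‖Complex.exp (θ * Complex.I)‖ = 1 := Complex.norm_exp_ofReal_mul_I θ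
  have hclose1 : ‖eΨ - Complex.exp (θ * Complex.I) • eΦ‖ ≤ g / 8 := by
    refine (pow_le_pow_iff_left₀ (norm_nonneg _) (by positivity) two_ne_zero).1 ?_
    rw [heΨ, heΦ, norm_formEmbed_sub_smul_sq hL hv hW Ψ Φ]
    exact hθ
  set u : L2T N := (Complex.exp (θ * Complex.I) * c) • f with hu
  have hwc : ‖Complex.exp (θ * Complex.I) * c‖ = 1 := by rw [norm_mul, hw1, hc1, one_mul]
  have hu1 : ‖u‖ = 1 := by rw [hu, norm_smul, hwc, hf1, one_mul]
  have hclose2 : ‖eΨ - u‖ ≤ g / 4 := by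
    have h1 : Complex.exp (θ * Complex.I) • eΦ - u = Complex.exp (θ * Complex.I) • (eΦ - η₀) := by
      rw [hu, hc, smul_sub, smul_smul]
    calc ‖eΨ - u‖
        = ‖(eΨ - Complex.exp (θ * Complex.I) • eΦ) + (Complex.exp (θ * Complex.I) • eΦ - u)‖ := by
          rw [sub_add_sub_cancel]
      _ ≤ ‖eΨ - Complex.exp (θ * Complex.I) • eΦ‖ + ‖Complex.exp (θ * Complex.I) • eΦ - u‖ :=
          norm_add_le _ _
      _ ≤ g / 8 + g / 8 := by
          refine add_le_add hclose1 ?_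
          rw [h1, norm_smul, hw1, one_mul]
          exact hΦclose.le
      _ = g / 4 := by ring
  -- stability of the amplitude and the floor of the reference
  have hstab := abs_re_inner_map_sub_le (τ[toUnitTorusN L C]) eΨ u
  rw [heΨ1, hu1] at hstab
  have hfl : g ≤ (⟪(τ[toUnitTorusN L C] u : L2T N), u⟫_ℂ).re := by
    rw [hu, re_inner_map_smul_self _ f hwc]; exact hfloor _
  rw [← inner_translate_formEmbed_trialState hL hv hW Ψ C]
  nlinarith [(abs_sub_le_iff.1 hstab).2, hfl, hclose2, hg, norm_nonneg (eΨ - u)]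

end CoherencePosL2

open CoherencePosL2 in
/-- **Registered stub `stub_coherencePos_integrable` of line `registered` (crux `GridInfDivCoherence`,
stmt-AtomisticToContinuum-9114): positivity of the translation coherence of near-minimisers, INTEGRABLE
pair profiles.** For every repulsive finite-range pair potential `v` with `∫_{ℝ³} v(|x|) dx < ∞` (bounded or
not) there is `ρ₀ > 0` (any density works; `ρ₀ = 1`) such that for `0 < ρ < ρ₀` and all `N ≥ 1` some `δ > 0`
makes EVERY `δ`-near-minimiser `Ψ` of the periodic `N`-body energy on the torus of side `L = (N/ρ)^{1/3}` have
`re ∫_{cell^N} conj Ψ(…, xᵢ + r, …) Ψ(X) dX > 0` for every particle `i` and every `r ∈ ℝ³`: `W ∈ L¹` of the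
cell (`lintegral_cellN_periodicInteraction_ne_top_of_lintegral_ne_top`) and
`re_setIntegral_conj_translate_mul_pos` (simplicity of the max-form ground state, its a.e. positivity,
strong continuity of translation on `L²` of the torus, clustering from the Ky Fan gap).
[cite: ReedSimonIV1978, Thms XIII.44 and XIII.48 (a)] -/
theorem stub_coherencePos_integrable :
    ∀ v : ℝ → ℝ≥0∞, IsRepulsiveFiniteRange v → (∫⁻ x : Space, v ‖x‖) ≠ ⊤ →
      ∃ ρ₀ : ℝ, 0 < ρ₀ ∧ ∀ ρ : ℝ, 0 < ρ → ρ < ρ₀ → ∀ᶠ N : ℕ in atTop, ∃ δ : ℝ≥0∞, 0 < δ ∧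
        ∀ Ψ : PeriodicTrialState N (sideLength ρ N),
          periodicEnergy v Ψ ≤ periodicGroundStateEnergy v N (sideLength ρ N) + δ → ∀ i : Fin N,
            ∀ r, 0 < (∫ X in cellN N (sideLength ρ N),
              conj (Ψ.ψ (Function.update X i (X i + r))) * Ψ.ψ X).re := by
  intro v hv hint
  refine ⟨1, one_pos, fun ρ hρ _ => ?_⟩
  filter_upwards [eventually_ge_atTop 1] with N hN
  have hL : 0 < sideLength ρ N := Real.rpow_pos_of_pos (div_pos (Nat.cast_pos.2 hN) hρ) _
  have hW := lintegral_cellN_periodicInteraction_ne_top_of_lintegral_ne_top hL hv.1 hint N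
  obtain ⟨δ, hδ, h⟩ := re_setIntegral_conj_translate_mul_pos hN hL hv.1 hW
  refine ⟨δ, hδ, fun Ψ hΨ i r => ?_⟩
  simp_rw [update_eq_add_single]
  exact h Ψ hΨ (Pi.single i r)

end Summit.AtomisticToContinuum.BoseEinsteinCondensation.Theorems

end
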